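import Mathlib
import HarnessLib.Audit
import Summits.PneNP.PneNP.Theorems.PstarChordBridgeAssemble
import Summits.PneNP.PneNP.Theorems.PstarCrossBlind

/-!
# The blind free CROSS gate as bridge data: the bundle `CrossData`, its construction from the raw E1 datum, and the link (O2 / E1; prover-1 g22)

FRONTIER range-avoidance ladder, rung F-N3 (`stmt-PneNP-19007`), cell `pnp-ideate` (planner memo `HOME/pnp-ideate-p3/r24/CORE-BOUND-NOTES.md`
§14.31–§14.33, §14.37–§14.48; this seat's `HOME/pnp-ideate-prover-1/g22/NOTES`); restricted-model proof complexity — nothing here bears on `P` versus `NP`.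

THE E1 RESIDUE OF O2.  `PstarCrossBlind.TerminalFiveCross1BlindOr` (⟹ `PstarCross2.TerminalFiveCross1Blind`, landed glue): a terminal pair `(w₁, w₂)` on an
XOR-closed core `J₀` with a maximal peelable `F`, ONE cross gate `g₀ = x_p · x_q` among the monomials of `w₁` (`p`, `q` privates of two distinct chords
`e_p`, `e_q` of `J₀ ∖ F`), every other monomial hun-clean, `w₂` blind to the four privates of `e_p, e_q`, in OR SHAPE (`p, q ∈ w₁.1`, the mates
`p', q' ∉ w₁.1`) and with `x_p ∨ x_q ≡ 1` on `Z = Sol_y(J₀) ∩ {w₂ = t₂}`.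

THE VIRTUAL-CHORD LINE (this seat).  Remove `g₀` from the monomials of `w₁` but KEEP the linear reads `x_p + x_q`: the resulting pair `(R, w₂)` has no
cross pendant, so the landed packaging gives BRIDGE DATA `B` (`PstarChordBridge`) with `B.J₀ = J₀`, `B.N = J₀ ∖ F`, constraints `(w₁.1, w₁.2.1 ∖ g₀, t₁)`,
`w₂`, well-formed and liftable; in its chord system BOTH `e_p` and `e_q` are read with the constant vector `(1,0)` through `p`, `q` and nothing else, and the
real first constraint is `R + x_p x_q`.  At a base point the OR pair then contributes `{0, (1,0)}` iff both prescribed products vanish and `{(1,0)}`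
otherwise — exactly ONE clean chord with prescribed product `u_p ∨ u_q` (the virtual chord; next file `PstarCrossSystem`).

This file:
* `CSolution` — the REAL system (gate put back) on an output set; `CrossData I r B e_p e_q g₀` — the bundle (well-formed liftable bridge data on an
  XOR-closed core with peelable co-chords, radius WITH the footprint of `g₀`, hun-cleanness, OR shape, blindness, (T3)/(M0) for the real system in every
  output, `x_p ∨ x_q ≡ 1` on `Z`, freeness of `p` and `q` on `Z`), orientation `p = vars e_p 2`, `q = vars e_q 2`, `g₀ = (p, q)`;
* `crossData_of_terminal` — the raw datum in that orientation gives `CrossData` with `B.J₀ = J₀`;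
* `CrossCount` (`@[conjecture]`, OPEN) — cross data have `#J₀ ≤ 5`.  The link `CrossCount → TerminalFiveCross1BlindOr` (all four orientations, through
  the AND-slot swaps `PstarSlotSwap.swapAnd` of `e_p` and `e_q`) is the next file `PstarCrossLink`.
Expansion remark (for the successor nodes; CORRECTED — an earlier version of this docstring forgot the two XOR inputs of `g₀` and claimed `+ 7` /
`#J₀ ≥ 7`): on `J₀ ∪ {g₀}` both AND variables of the gate are chord privates, so the gate pays only its two XOR inputs and `(r,3/2)`-expansion reads
`#(J₀ ∖ N) + 3 ≤ #N + 2·#{private tree edges}` (`PstarCrossBudget.cross_budget`; the one-gate budget of E2 has `+ 1`).  Counting alone does NOT exclude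
cross data with `#J₀ ≤ 5`, and the parenthetical "(equivalently … there are none)" in the docstring of `CrossCount` below (kept byte-identical, append-only) is VOID.
-/

set_option linter.dupNamespace false -- `Summit.PneNP.PneNP.…`: summit = sub-problem name (D-0017 single-conjunct layout)

open Finset Literature.Computability.Complexity
open Summit.PneNP.PneNP.Theorems.PstarTyped (Typed)
open Summit.PneNP.PneNP.Theorems.PstarSALevel (varSet bdry BoundaryExpanding SimpleOverlap)
open Summit.PneNP.PneNP.Theorems.PstarGapPeeling (not_mem_varSet_of_private)
open Summit.PneNP.PneNP.Theorems.PstarCentreFree (vars_mem_varSet)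
open Summit.PneNP.PneNP.Theorems.PstarGapOneAll (gval)
open Summit.PneNP.PneNP.Theorems.PstarXCore (xpair xverts)
open Summit.PneNP.PneNP.Theorems.PstarCoreBound (XorClosed)
open Summit.PneNP.PneNP.Theorems.PstarChordRepair (IsChord)
open Summit.PneNP.PneNP.Theorems.PstarChordBridgeTools (xpdeg privs mem_privs vars_mem_privs)
open Summit.PneNP.PneNP.Theorems.PstarChordBridge (BridgeData Lift)
open Summit.PneNP.PneNP.Theorems.PstarChordBridgeLift (lift_of_wf_peelable)
open Summit.PneNP.PneNP.Theorems.PstarChordBridgeCotree (Peelable exists_fundamental_of_maximal sdiff_nonempty_of_xorClosed)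
open Summit.PneNP.PneNP.Theorems.PstarChordBridgeJoin (exists_join_of_terminal)
open Summit.PneNP.PneNP.Theorems.PstarChordBridgeAssemble (reflTransGen_mono ends_connected_of_even)
open Summit.PneNP.PneNP.Theorems.PstarCoreBoundTargets (Terminal)
open Summit.PneNP.PneNP.Theorems.PstarUnion (SatPair)
open Summit.PneNP.PneNP.Theorems.PstarChordReadShared (gval_singleton)
open Summit.PneNP.PneNP.Theorems.PstarCross (CrossGate)
open Summit.PneNP.PneNP.Theorems.PstarCross2 (touchedBy)
open Summit.PneNP.PneNP.Theorems.PstarCrossBlind (TerminalFiveCross1BlindOr)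

namespace Summit.PneNP.PneNP.Theorems.PstarCrossData

variable {n m : ℕ}

/-! ## The bundle -/

/-- `z` solves the REAL cross system on the output set `K`: the outputs of `K`, the first constraint WITH the gate `g₀` put back, and the second. -/
def CSolution (I : LocalMap 4 n m) (B : BridgeData n m) (g₀ : Fin m) (K : Finset (Fin m)) (z : Fin n → Bool) : Prop :=
  (∀ j ∈ K, I.eval z j = B.y j) ∧ gval I B.C₁ (insert g₀ B.G₁) z = B.b₁ ∧ gval I B.C₂ B.G₂ z = B.b₂

/-- **Cross data** (orientation `p = vars e_p 2`, `q = vars e_q 2`, `g₀ = (p, q)`): well-formed liftable bridge data `B` on an XOR-closed core with peelable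
co-chords, whose first constraint is the gate-free part `R` of `w₁` (linear reads `x_p + x_q` kept) and whose second is `w₂`; radius with the footprint of
the cross gate `g₀`; every chord private untouched by the monomials of `R, w₂`; OR shape and blindness; (T3)/(M0) of the REAL system `(R + x_p x_q, w₂)` in every
output of `J₀`; `x_p ∨ x_q ≡ 1` on `Z = Sol(J₀) ∩ {w₂ = t₂}`; `p` and `q` free on `Z`. -/
structure CrossData (I : LocalMap 4 n m) (r : ℕ) (B : BridgeData n m) (e_p e_q g₀ : Fin m) : Prop where
  /-- well-formed bridge data -/
  wf : B.WF I
  /-- radius with the footprint of the gate -/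
  rad : (B.J₀ ∪ insert g₀ B.G₁ ∪ B.G₂).card ≤ r
  /-- the monomials of the real first constraint lie off the core -/
  disj₁ : Disjoint (insert g₀ B.G₁) B.J₀
  /-- the monomials of the second constraint lie off the core -/
  disj₂ : Disjoint B.G₂ B.J₀
  /-- the non-chord part lifts -/
  lift : Lift I B
  /-- the non-chords are peelable -/
  peel : Peelable I (B.J₀ \ B.N)
  /-- the core is XOR-closed -/
  closed : XorClosed I B.J₀
  /-- the chord of `p` -/
  mem_p : e_p ∈ B.N
  /-- the chord of `q` -/
  mem_q : e_q ∈ B.N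
  /-- the two chords are distinct -/
  ne : e_p ≠ e_q
  /-- the gate is not among the clean monomials -/
  gate_nmem : g₀ ∉ B.G₁
  /-- the gate is `(p, q)` -/
  gate_vars : I.vars g₀ 2 = I.vars e_p 2 ∧ I.vars g₀ 3 = I.vars e_q 2
  /-- hun-cleanness: no clean monomial touches a chord private -/
  hun : ∀ v ∈ privs I B.N, (∀ g ∈ B.G₁, I.vars g 2 ≠ v ∧ I.vars g 3 ≠ v) ∧ ∀ g ∈ B.G₂, I.vars g 2 ≠ v ∧ I.vars g 3 ≠ v
  /-- OR shape: `p, q` read linearly by the first constraint, the mates not -/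
  or_shape : I.vars e_p 2 ∈ B.C₁ ∧ I.vars e_q 2 ∈ B.C₁ ∧ I.vars e_p 3 ∉ B.C₁ ∧ I.vars e_q 3 ∉ B.C₁
  /-- blindness: the second constraint reads none of the four privates -/
  blind : I.vars e_p 2 ∉ B.C₂ ∧ I.vars e_p 3 ∉ B.C₂ ∧ I.vars e_q 2 ∉ B.C₂ ∧ I.vars e_q 3 ∉ B.C₂
  /-- (T3): the real system on `J₀` has no solution -/
  T3 : ¬ ∃ z, CSolution I B g₀ B.J₀ z
  /-- (M0): deleting any output of `J₀` makes the real system solvable -/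
  M0 : ∀ f ∈ B.J₀, ∃ z, CSolution I B g₀ (B.J₀.erase f) z
  /-- `x_p ∨ x_q ≡ 1` on `Z` -/
  or_on_Z : ∀ z : Fin n → Bool, (∀ j ∈ B.J₀, I.eval z j = B.y j) → gval I B.C₂ B.G₂ z = B.b₂ →
    z (I.vars e_p 2) = true ∨ z (I.vars e_q 2) = true
  /-- `p` is free on `Z` -/
  free_p : ∀ c : Bool, ∃ z : Fin n → Bool, (∀ j ∈ B.J₀, I.eval z j = B.y j) ∧ z (I.vars e_p 2) = c ∧ gval I B.C₂ B.G₂ z = B.b₂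
  /-- `q` is free on `Z` -/
  free_q : ∀ c : Bool, ∃ z : Fin n → Bool, (∀ j ∈ B.J₀, I.eval z j = B.y j) ∧ z (I.vars e_q 2) = c ∧ gval I B.C₂ B.G₂ z = B.b₂

/-- The common target: cross data have a core of at most five outputs (equivalently, by the expansion remark of the module docstring: there are none). -/
@[conjecture] def CrossCount : Prop :=
  ∀ (n m r : ℕ) (I : LocalMap 4 n m), I.IsPure xorAndPred → Typed I → SimpleOverlap I → BoundaryExpanding r I →
  ∀ (B : BridgeData n m) (e_p e_q g₀ : Fin m), CrossData I r B e_p e_q g₀ → B.J₀.card ≤ 5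

/-! ## From the raw datum to cross data (orientation `(2, 2)`) -/

/-- **Cross data from the raw E1 datum** (orientation `vars g₀ 2 = vars e_p 2`, `vars g₀ 3 = vars e_q 2`).  See the module docstring. -/
theorem crossData_of_terminal (I : LocalMap 4 n m) (hI : I.IsPure xorAndPred) (hT : Typed I) (hS : SimpleOverlap I) {r : ℕ}
    (hB : BoundaryExpanding r I) {y : Fin m → Bool} {J₀ : Finset (Fin m)} {w₁ w₂ : Finset (Fin n) × Finset (Fin m) × Bool}
    (ht : Terminal I r y J₀ w₁ w₂) {F : Finset (Fin m)} (hF : F ⊆ J₀) (hP : Peelable I F)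
    (hmax : ∀ F', F ⊆ F' → F' ⊆ J₀ → Peelable I F' → F' = F) (hch : ∀ e ∈ J₀ \ F, IsChord I J₀ e)
    {g₀ : Fin m} (hg₀ : g₀ ∈ w₁.2.1) {e_p e_q : Fin m} (hep : e_p ∈ J₀ \ F) (heq : e_q ∈ J₀ \ F)
    (hgp : I.vars g₀ 2 = I.vars e_p 2) (hgq : I.vars g₀ 3 = I.vars e_q 2)
    (hun : ∀ g ∈ (w₁.2.1.erase g₀) ∪ w₂.2.1, ∀ v ∈ privs I (J₀ \ F), I.vars g 2 ≠ v ∧ I.vars g 3 ≠ v)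
    (h2 : ∀ c : Bool, SatPair I y J₀ (({I.vars g₀ 2} : Finset (Fin n)), (∅ : Finset (Fin m)), c) w₂)
    (h3 : ∀ c : Bool, SatPair I y J₀ (({I.vars g₀ 3} : Finset (Fin n)), (∅ : Finset (Fin m)), c) w₂)
    (hbl : ∀ e ∈ touchedBy I J₀ F g₀, I.vars e 2 ∉ w₂.1 ∧ I.vars e 3 ∉ w₂.1)
    (hpC : I.vars g₀ 2 ∈ w₁.1) (hqC : I.vars g₀ 3 ∈ w₁.1)
    (hmates : ∀ e ∈ touchedBy I J₀ F g₀, ∀ s : Fin 4, 2 ≤ s.val → I.vars e s ≠ I.vars g₀ 2 → I.vars e s ≠ I.vars g₀ 3 → I.vars e s ∉ w₁.1)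
    (hZor : ∀ z : Fin n → Bool, (∀ j ∈ J₀, I.eval z j = y j) → gval I w₂.1 w₂.2.1 z = w₂.2.2 →
      z (I.vars g₀ 2) = true ∨ z (I.vars g₀ 3) = true) :
    ∃ B : BridgeData n m, B.J₀ = J₀ ∧ B.y = y ∧ B.N = J₀ \ F ∧ B.C₁ = w₁.1 ∧ B.G₁ = w₁.2.1.erase g₀ ∧ B.b₁ = w₁.2.2 ∧
      B.C₂ = w₂.1 ∧ B.G₂ = w₂.2.1 ∧ B.b₂ = w₂.2.2 ∧ CrossData I r B e_p e_q g₀ := by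
  classical
  obtain ⟨hne0, hX, hJr, hd₁, hd₂, hrad, hT3, hM0⟩ := id ht
  have hFN : J₀ \ (J₀ \ F) = F := Finset.sdiff_sdiff_eq_self hF
  have hepJ : e_p ∈ J₀ := (mem_sdiff.1 hep).1
  have heqJ : e_q ∈ J₀ := (mem_sdiff.1 heq).1
  have hg₀J : g₀ ∉ J₀ := fun h => disjoint_left.1 hd₁ h hg₀
  -- the two chords are distinct (else `g₀` and `e_p` share two variables)
  have hne : e_p ≠ e_q := by
    intro h
    subst h
    have h2v : I.vars g₀ 2 ∈ varSet I g₀ ∩ varSet I e_p := mem_inter.2 ⟨vars_mem_varSet I g₀ 2, hgp ▸ vars_mem_varSet I e_p 2⟩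
    have h3v : I.vars g₀ 3 ∈ varSet I g₀ ∩ varSet I e_p := mem_inter.2 ⟨vars_mem_varSet I g₀ 3, hgq ▸ vars_mem_varSet I e_p 2⟩
    have hpq : I.vars g₀ 2 ≠ I.vars g₀ 3 := fun h => absurd (hI.2 g₀ h) (by decide)
    have := hS g₀ e_p (fun h => hg₀J (h ▸ hepJ))
    exact absurd (card_le_one.1 this _ h2v _ h3v) hpq
  -- the touched chords
  have hep_t : e_p ∈ touchedBy I J₀ F g₀ := mem_filter.2 ⟨hep, Or.inl hgp⟩
  have heq_t : e_q ∈ touchedBy I J₀ F g₀ := mem_filter.2 ⟨heq, Or.inr (Or.inr (Or.inl hgq))⟩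
  -- fundamental sets
  have hfund : ∀ e, ∃ D : Finset (Fin m), e ∈ J₀ \ F → D ⊆ F ∧ e ∉ D ∧ ∀ w, Even (xpdeg I (insert e D) w) := by
    intro e
    by_cases he : e ∈ J₀ \ F
    · obtain ⟨D, hD, heD, hev⟩ := exists_fundamental_of_maximal I hI hF hP hmax he
      exact ⟨D, fun _ => ⟨hD, heD, hev⟩⟩
    · exact ⟨∅, fun h => absurd h he⟩
  choose D hD using hfund
  have hconn : ∀ e ∈ J₀, Relation.ReflTransGen (fun x y => ∃ j ∈ F, x ∈ xpair I j ∧ y ∈ xpair I j) (I.vars e 0) (I.vars e 1) := by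
    intro e he
    by_cases heF : e ∈ F
    · exact Relation.ReflTransGen.single ⟨e, heF, (PstarXCore.mem_xpair I).2 (Or.inl rfl), (PstarXCore.mem_xpair I).2 (Or.inr rfl)⟩
    · obtain ⟨hDF, heD, hev⟩ := hD e (mem_sdiff.2 ⟨he, heF⟩)
      exact reflTransGen_mono I hDF (ends_connected_of_even I hI heD hev)
  -- joins of the XOR reads of the ORIGINAL pair (they depend on the linear parts only)
  obtain ⟨⟨T₁, hT₁F, hT₁⟩, ⟨T₂, hT₂F, hT₂⟩⟩ :=
    exists_join_of_terminal I hI hT hS hB y hne0 hJr.le hd₁ hd₂ hT3 hM0 (F := F) hconn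
  -- the data: the gate removed from the monomials of the first constraint, its linear reads kept
  let B : BridgeData n m :=
    { y := y, J₀ := J₀, N := J₀ \ F, D := D, C₁ := w₁.1, G₁ := w₁.2.1.erase g₀, b₁ := w₁.2.2, T₁ := T₁,
      C₂ := w₂.1, G₂ := w₂.2.1, b₂ := w₂.2.2, T₂ := T₂ }
  have hW : B.WF I :=
    { hN := sdiff_subset
      hchord := hch
      hD := fun e he => by show D e ⊆ J₀ \ (J₀ \ F); rw [hFN]; exact (hD e he).1
      hDeven := fun e he => (hD e he).2.2
      hT₁ := by show T₁ ⊆ J₀ \ (J₀ \ F); rw [hFN]; exact hT₁F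
      hT₂ := by show T₂ ⊆ J₀ \ (J₀ \ F); rw [hFN]; exact hT₂F
      hjoin₁ := fun w => by show Odd (xpdeg I T₁ w) ↔ w ∈ w₁.1 ∧ w ∈ xverts I (J₀ \ (J₀ \ F)); rw [hFN]; exact hT₁ w
      hjoin₂ := fun w => by show Odd (xpdeg I T₂ w) ↔ w ∈ w₂.1 ∧ w ∈ xverts I (J₀ \ (J₀ \ F)); rw [hFN]; exact hT₂ w
      hcross₁ := fun g hg h => (hun g (mem_union_left _ hg) _ h.1).1 rfl
      hcross₂ := fun g hg h => (hun g (mem_union_right _ hg) _ h.1).1 rfl }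
  have hL : Lift I B := lift_of_wf_peelable I hI hT B (by show Peelable I (J₀ \ (J₀ \ F)); rw [hFN]; exact hP)
  have hins : insert g₀ (w₁.2.1.erase g₀) = w₁.2.1 := insert_erase hg₀
  have hsol : ∀ K z, CSolution I B g₀ K z ↔
      (∀ j ∈ K, I.eval z j = y j) ∧ gval I w₁.1 w₁.2.1 z = w₁.2.2 ∧ gval I w₂.1 w₂.2.1 z = w₂.2.2 := by
    intro K z
    show (∀ j ∈ K, I.eval z j = y j) ∧ gval I w₁.1 (insert g₀ (w₁.2.1.erase g₀)) z = w₁.2.2 ∧ gval I w₂.1 w₂.2.1 z = w₂.2.2 ↔ _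
    rw [hins]
  refine ⟨B, rfl, rfl, rfl, rfl, rfl, rfl, rfl, rfl, rfl, ?_⟩
  exact
    { wf := hW
      rad := by show (J₀ ∪ insert g₀ (w₁.2.1.erase g₀) ∪ w₂.2.1).card ≤ r; rw [hins]; exact hrad
      disj₁ := by show Disjoint (insert g₀ (w₁.2.1.erase g₀)) J₀; rw [hins]; exact hd₁.symm
      disj₂ := hd₂.symm
      lift := hL
      peel := by show Peelable I (J₀ \ (J₀ \ F)); rw [hFN]; exact hP
      closed := hX
      mem_p := hep
      mem_q := heq
      ne := hne
      gate_nmem := fun h => (mem_erase.1 h).1 rfl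
      gate_vars := ⟨hgp, hgq⟩
      hun := fun v hv => ⟨fun g hg => hun g (mem_union_left _ hg) v hv, fun g hg => hun g (mem_union_right _ hg) v hv⟩
      or_shape := by
        refine ⟨hgp ▸ hpC, hgq ▸ hqC, ?_, ?_⟩
        · have h23 : I.vars e_p 3 ≠ I.vars e_p 2 := fun h => absurd (hI.2 e_p h) (by decide)
          refine hmates e_p hep_t 3 (by decide) (hgp ▸ h23) fun h => ?_
          -- `vars e_p 3 = vars g₀ 3 = vars e_q 2`: a private of two distinct chords
          have := PstarChordBridgeTools.chord_eq_of_vars_eq I (J₀ := J₀) (N := J₀ \ F) sdiff_subset hch hep heqJ (s := 3) (s' := 2)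
            (by decide) (h.trans hgq)
          exact hne this.symm
        · have h23 : I.vars e_q 3 ≠ I.vars e_q 2 := fun h => absurd (hI.2 e_q h) (by decide)
          refine hmates e_q heq_t 3 (by decide) (fun h => ?_) (hgq ▸ h23)
          have := PstarChordBridgeTools.chord_eq_of_vars_eq I (J₀ := J₀) (N := J₀ \ F) sdiff_subset hch heq hepJ (s := 3) (s' := 2)
            (by decide) (h.trans hgp)
          exact hne this
      blind := ⟨(hbl e_p hep_t).1, (hbl e_p hep_t).2, (hbl e_q heq_t).1, (hbl e_q heq_t).2⟩
      T3 := fun ⟨z, hz⟩ => hT3 ⟨z, (hsol J₀ z).1 hz⟩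
      M0 := fun f hf => by
        obtain ⟨z, hz⟩ := hM0 f hf
        exact ⟨z, (hsol _ z).2 hz⟩
      or_on_Z := fun z hz hzw => by rw [← hgp, ← hgq]; exact hZor z hz hzw
      free_p := fun c => by
        obtain ⟨z, hz, h1, h2'⟩ := h2 c
        refine ⟨z, hz, ?_, h2'⟩
        have h : gval I {I.vars g₀ 2} ∅ z = c := h1
        rwa [gval_singleton, hgp] at h
      free_q := fun c => by
        obtain ⟨z, hz, h1, h2'⟩ := h3 c
        refine ⟨z, hz, ?_, h2'⟩
        have h : gval I {I.vars g₀ 3} ∅ z = c := h1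
        rwa [gval_singleton, hgq] at h }


end Summit.PneNP.PneNP.Theorems.PstarCrossData
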